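import Summits.NavierStokesRegularity.NavierStokesRegularity.Theses.PerpetualPump
import Literature.Analysis.FluidPDE.TaoAveragedCascadeHolds

/-!
# Crux `Thesis` (stmt-NavierStokesRegularity-1832), negative side: the Type-I rate hypothesis is load-bearing

Negative-side (cdisprove, D-0016) support lemmas extracted from `Cruxes/Thesis/Disproof.lean` (cycle 1, §3c).
`Thesis` (route target of `PerpetualPump`) says: every `H¹⁰_df`-mild solution of a symmetric cancelling
averaged Navier–Stokes equation on `[0,T)` obeying the Type-I rate `‖u(t)‖_∞ ≤ M(T-t)^{-1/2}` extends past
`T`. Delete the rate hypothesis and the statement becomes "every mild solution continues" — which is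
FALSE modulo local existence, because it contradicts Tao's Theorem 1.5, a THEOREM of the tree
(`Tao2016.averagedNS_blowup_holds`: some symmetric cancelling averaged equation has a Schwartz
divergence-free datum with NO global mild solution). The link is a soft fact of independent use:

* `exists_global_of_forall_extends` — **continuation + local existence ⇒ global existence**: if a mild
  solution of `∂ₜu = Δu + F(u,u)` from `a` exists on some `[0,T₀)` and every mild solution on every
  `[0,T)` extends to a strictly longer `[0,T')`, then a GLOBAL mild solution `[0,∞) → H¹⁰_df` exists.
  Zorn's lemma (relation form, `exists_maximal_of_nonempty_chains_bounded`) on the extension relation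
  between pairs (lifetime, curve); chains glue (`glue_mild`, the glued curve chosen by `Classical.epsilon`)
  because membership and the Duhamel identity (1.15) at time `t` only look back at `[0,t]` and
  `H¹⁰`-continuity is local in time. NO uniqueness of mild solutions is used; no definitions are added.
* `exists_nonextendable_of_localExistence` — Theorem 1.5 in LOCAL form modulo local existence: a mild
  solution on some `[0,T)`, `T > 0`, with no mild extension past `T` (crux #3 `AveragedTypeIBlowup`
  without its rate conjunct).
* `thesisWithoutRate_false_of_localExistence` — hence `Thesis` with the rate hypothesis deleted is false
  (modulo local existence): any proof of `Thesis` must USE the Type-I bound near `T`, and the content of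
  the crux is entirely in the RATE of the singularity (Theorem 1.5's witness is Type II,
  `‖u(t)‖_∞ ≈ (T-t)^{-3/5+O(ε)}`, p. 8).

Local existence of `H¹⁰_df`-mild solutions from Schwartz divergence-free data (Tao 2016, remark after
(1.15): standard, `B̃ : H¹⁰_df × H¹⁰_df → H⁹`, `e^{τΔ} : H⁹ → H¹⁰` with norm `O(τ^{-1/2})`) holds for
every averaging datum but is not in the tree; it enters as the hypothesis `hloc`. Nothing here closes the
item (`--supports`); no statement of the route changes.

## References

* T. Tao, J. Amer. Math. Soc. 29 (2016), 601–674 = arXiv:1402.0290v3, Thm. 1.5, §1.1 (1.15) and the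
  remark following it, footnote p. 8. [`Tao2016AveragedNS`]
-/

noncomputable section

namespace Summit.NavierStokesRegularity.NavierStokesRegularity.Theorems.Thesis.Negative

open MeasureTheory Set Filter Topology
open scoped ENNReal SchwartzMap
open Literature.Analysis.FluidPDE Literature.Analysis.FluidPDE.Tao2016
open Summit.NavierStokesRegularity.NavierStokesRegularity.Theses.PerpetualPump

/-- **On a chain for the extension relation, the glued curve agrees with every member throughout that
member's lifetime.** Pairs `p = (T, u)` (lifetime, curve); extension relation: `q` lives at least as
long as `p` and agrees with `p` on `[0, p.1)`; glued curve at `t`: the curve of a member alive at `t`,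
chosen by `Classical.epsilon`. [folklore] -/
theorem glue_eq {c : Set (ℝ × (ℝ → L2C))}
    (hc : IsChain (fun p q : ℝ × (ℝ → L2C) => p.1 ≤ q.1 ∧ ∀ t ∈ Ico 0 p.1, q.2 t = p.2 t) c)
    {p : ℝ × (ℝ → L2C)} (hp : p ∈ c) {t : ℝ} (ht : t ∈ Ico 0 p.1) :
    (Classical.epsilon (fun q : ℝ × (ℝ → L2C) => q ∈ c ∧ t < q.1)).2 t = p.2 t := by
  have h : ∃ q : ℝ × (ℝ → L2C), q ∈ c ∧ t < q.1 := ⟨p, hp, ht.2⟩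
  have hspec := Classical.epsilon_spec h
  set q := Classical.epsilon (fun q : ℝ × (ℝ → L2C) => q ∈ c ∧ t < q.1) with hq
  by_cases hne : q = p
  · rw [hne]
  · rcases hc hspec.1 hp hne with hqp | hpq
    · exact (hqp.2 t ⟨ht.1, hspec.2⟩).symm
    · exact hpq.2 t ht

/-- **A chain of mild solutions glues to a mild solution on the union of the lifetimes**
(`⋃_{p ∈ c} [0, p.1)`): membership in `H¹⁰_df` and the Duhamel identity at `t` are read off any member
alive at `t` (the identity only looks back at `[0,t]`), and `H¹⁰`-continuity within the union at `t₀`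
is that of a member alive at `t₀`, the union agreeing with that member's segment below its lifetime.
[folklore] -/
theorem glue_mild {F : L2C → L2C → L2C → ℂ} {a : L2C} {c : Set (ℝ × (ℝ → L2C))}
    (hcS : ∀ p ∈ c, IsMildSolutionFor F a (Ico 0 p.1) p.2)
    (hc : IsChain (fun p q : ℝ × (ℝ → L2C) => p.1 ≤ q.1 ∧ ∀ t ∈ Ico 0 p.1, q.2 t = p.2 t) c) :
    IsMildSolutionFor F a {t | 0 ≤ t ∧ ∃ p ∈ c, t < p.1}
      (fun t => (Classical.epsilon (fun q : ℝ × (ℝ → L2C) => q ∈ c ∧ t < q.1)).2 t) := by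
  refine ⟨fun t ht => ?_, fun t₀ ht₀ => ?_, fun t ht w hw => ?_⟩
  · obtain ⟨ht0, p, hp, htp⟩ := ht
    dsimp only
    rw [glue_eq hc hp ⟨ht0, htp⟩]
    exact (hcS p hp).1 t ⟨ht0, htp⟩
  · obtain ⟨ht0, p, hp, htp⟩ := ht₀
    have hset : {t : ℝ | 0 ≤ t ∧ ∃ p ∈ c, t < p.1} ∩ Iio p.1 = Ico 0 p.1 := by
      ext t
      constructor
      · rintro ⟨⟨h0, -⟩, hlt⟩
        exact ⟨h0, hlt⟩
      · intro h
        exact ⟨⟨h.1, p, hp, h.2⟩, h.2⟩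
    have hnhds : 𝓝[{t : ℝ | 0 ≤ t ∧ ∃ p ∈ c, t < p.1}] t₀ = 𝓝[Ico 0 p.1] t₀ := by
      rw [nhdsWithin_restrict' _ (Iio_mem_nhds htp), hset]
    rw [hnhds]
    refine ((hcS p hp).2.1 t₀ ⟨ht0, htp⟩).congr' ?_
    filter_upwards [self_mem_nhdsWithin] with t ht
    rw [glue_eq hc hp ht, glue_eq hc hp ⟨ht0, htp⟩]
  · obtain ⟨ht0, p, hp, htp⟩ := ht
    have htI : t ∈ Ico 0 p.1 := ⟨ht0, htp⟩
    dsimp only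
    rw [glue_eq hc hp htI, (hcS p hp).2.2 t htI w hw]
    congr 1
    refine intervalIntegral.integral_congr fun s hs => ?_
    rw [uIcc_of_le ht0] at hs
    rw [glue_eq hc hp ⟨hs.1, hs.2.trans_lt htp⟩]

/-- **Continuation + local existence ⇒ global existence** (Zorn's lemma on coherent families of mild
solutions; no uniqueness theory is used). If some `H¹⁰_df`-mild solution of `∂ₜu = Δu + F(u,u)` from `a`
exists on some `[0,T₀)`, `T₀ > 0`, and EVERY mild solution on EVERY `[0,T)`, `T > 0`, extends to a mild
solution on a strictly longer `[0,T')` agreeing with it on `[0,T)`, then there is a global mild solution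
`u : [0,∞) → H¹⁰_df`. (Chains of the extension relation glue — to a longer pair if their lifetimes are
bounded, to a global solution otherwise — so a maximal pair exists, and it contradicts the continuation
hypothesis.) [folklore] -/
theorem exists_global_of_forall_extends {F : L2C → L2C → L2C → ℂ} {a : L2C}
    (hloc : ∃ T : ℝ, 0 < T ∧ ∃ u : ℝ → L2C, IsMildSolutionFor F a (Ico 0 T) u)
    (hext : ∀ T : ℝ, 0 < T → ∀ u : ℝ → L2C, IsMildSolutionFor F a (Ico 0 T) u →
      ∃ T' : ℝ, T < T' ∧ ∃ v : ℝ → L2C, IsMildSolutionFor F a (Ico 0 T') v ∧ ∀ t ∈ Ico 0 T, v t = u t) :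
    ∃ u : ℝ → L2C, IsMildSolutionFor F a (Ici 0) u := by
  by_contra hno
  obtain ⟨T₀, hT₀, u₀, hu₀⟩ := hloc
  -- the admissible pairs and the extension relation
  let α := {p : ℝ × (ℝ → L2C) // 0 < p.1 ∧ IsMildSolutionFor F a (Ico 0 p.1) p.2}
  let r : α → α → Prop := fun p q => p.1.1 ≤ q.1.1 ∧ ∀ t ∈ Ico 0 p.1.1, q.1.2 t = p.1.2 t
  haveI : Nonempty α := ⟨⟨(T₀, u₀), hT₀, hu₀⟩⟩
  have htrans : ∀ {p q s : α}, r p q → r q s → r p s := fun hpq hqs =>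
    ⟨hpq.1.trans hqs.1, fun t ht => (hqs.2 t ⟨ht.1, ht.2.trans_le hpq.1⟩).trans (hpq.2 t ht)⟩
  have hchain : ∀ C : Set α, IsChain r C → C.Nonempty → ∃ ub : α, ∀ p ∈ C, r p ub := by
    intro C hC hne
    obtain ⟨p₀, hp₀⟩ := hne
    -- the image chain of plain pairs
    let c : Set (ℝ × (ℝ → L2C)) := Subtype.val '' C
    have hc : IsChain (fun p q : ℝ × (ℝ → L2C) => p.1 ≤ q.1 ∧ ∀ t ∈ Ico 0 p.1, q.2 t = p.2 t) c := by
      rintro _ ⟨x, hx, rfl⟩ _ ⟨y, hy, rfl⟩ hne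
      exact hC hx hy fun hxy => hne (congrArg Subtype.val hxy)
    have hcS : ∀ p ∈ c, IsMildSolutionFor F a (Ico 0 p.1) p.2 := by
      rintro _ ⟨q, -, rfl⟩
      exact q.2.2
    have hmild := glue_mild hcS hc
    by_cases hbdd : BddAbove (Prod.fst '' c)
    · have himg : (Prod.fst '' c).Nonempty := ⟨p₀.1.1, p₀.1, ⟨p₀, hp₀, rfl⟩, rfl⟩
      have hSpos : 0 < sSup (Prod.fst '' c) :=
        p₀.2.1.trans_le (le_csSup hbdd ⟨p₀.1, ⟨p₀, hp₀, rfl⟩, rfl⟩)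
      have hset : {t : ℝ | 0 ≤ t ∧ ∃ p ∈ c, t < p.1} = Ico 0 (sSup (Prod.fst '' c)) := by
        ext t
        constructor
        · rintro ⟨h0, p, hp, htp⟩
          exact ⟨h0, htp.trans_le (le_csSup hbdd ⟨p, hp, rfl⟩)⟩
        · rintro ⟨h0, htS⟩
          obtain ⟨_, ⟨p, hp, rfl⟩, htp⟩ := exists_lt_of_lt_csSup himg htS
          exact ⟨h0, p, hp, htp⟩
      rw [hset] at hmild
      refine ⟨⟨(sSup (Prod.fst '' c), _), hSpos, hmild⟩, fun p hp => ?_⟩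
      exact ⟨le_csSup hbdd ⟨p.1, ⟨p, hp, rfl⟩, rfl⟩, fun t ht => glue_eq hc ⟨p, hp, rfl⟩ ht⟩
    · exfalso
      apply hno
      have hset : {t : ℝ | 0 ≤ t ∧ ∃ p ∈ c, t < p.1} = Ici 0 := by
        ext t
        constructor
        · rintro ⟨h0, -⟩
          exact h0
        · intro h0
          obtain ⟨_, ⟨p, hp, rfl⟩, htp⟩ := not_bddAbove_iff.1 hbdd t
          exact ⟨h0, p, hp, htp⟩
      rw [hset] at hmild
      exact ⟨_, hmild⟩
  obtain ⟨m, hm⟩ := exists_maximal_of_nonempty_chains_bounded hchain htrans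
  obtain ⟨T', hT', v, hv, hvu⟩ := hext m.1.1 m.2.1 m.1.2 m.2.2
  have hle : r m ⟨(T', v), m.2.1.trans hT', hv⟩ := ⟨hT'.le, hvu⟩
  exact absurd (hm _ hle).1 (not_le.2 hT')

/-- **Theorem 1.5 in local form, modulo local existence.** If every symmetric averaging datum with
cancellation has local `H¹⁰_df`-mild solutions from Schwartz divergence-free data (`hloc`; Tao, remark
after (1.15)), then some symmetric averaging datum with cancellation has a Schwartz divergence-free
datum and a mild solution on some `[0,T)`, `T > 0`, admitting NO mild extension past `T` — i.e. crux #3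
`AveragedTypeIBlowup` with its rate conjunct deleted holds. From Theorem 1.5
(`averagedNS_blowup_holds`) and `exists_global_of_forall_extends`. [cite: Tao2016AveragedNS, Thm. 1.5] -/
theorem exists_nonextendable_of_localExistence
    (hloc : ∀ 𝒜 : AveragingDatum, 𝒜.IsSymmetric → 𝒜.HasCancellation →
      ∀ u₀ : 𝓢(EuclideanSpace ℝ (Fin 3), EuclideanSpace ℝ (Fin 3)), VectorCalculus.IsDivFree ⇑u₀ →
        ∃ T : ℝ, 0 < T ∧ ∃ u : ℝ → L2C, 𝒜.IsMildSolution (schwartzL2 u₀) (Ico 0 T) u) :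
    ∃ 𝒜 : AveragingDatum, 𝒜.IsSymmetric ∧ 𝒜.HasCancellation ∧
      ∃ u₀ : 𝓢(EuclideanSpace ℝ (Fin 3), EuclideanSpace ℝ (Fin 3)), VectorCalculus.IsDivFree ⇑u₀ ∧
        ∃ T : ℝ, 0 < T ∧ ∃ u : ℝ → L2C,
          𝒜.IsMildSolution (schwartzL2 u₀) (Ico 0 T) u ∧
          ¬ ∃ T' : ℝ, T < T' ∧ ∃ v : ℝ → L2C,
            𝒜.IsMildSolution (schwartzL2 u₀) (Ico 0 T') v ∧ ∀ t ∈ Ico 0 T, v t = u t := by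
  obtain ⟨𝒜, hs, hc, u₀, hdiv, hno⟩ := averagedNS_blowup_holds
  refine ⟨𝒜, hs, hc, u₀, hdiv, ?_⟩
  by_contra hall
  push Not at hall
  exact hno (exists_global_of_forall_extends (hloc 𝒜 hs hc u₀ hdiv) fun T hT u hu => hall T hT u hu)

/-- **The Type-I rate hypothesis of `Thesis` is load-bearing** (modulo local existence `hloc`): the
route target with the hypothesis `∃ M, ∀ t ∈ [0,T), ‖u(t)‖_∞ ≤ M(T-t)^{-1/2}` deleted — "every mild
solution of every symmetric cancelling averaged Navier–Stokes equation continues past every `T`" — is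
FALSE, since with local existence it yields global mild solutions for every datum
(`exists_global_of_forall_extends`), against Theorem 1.5 (`averagedNS_blowup_holds`). So any proof of
`Thesis` must use the Type-I bound near `T`, and the whole content of the crux is the RATE of the
singularity (Theorem 1.5's witness is Type II). [cite: Tao2016AveragedNS, Thm. 1.5 and §1.1 footnote p. 8] -/
theorem thesisWithoutRate_false_of_localExistence
    (hloc : ∀ 𝒜 : AveragingDatum, 𝒜.IsSymmetric → 𝒜.HasCancellation →
      ∀ u₀ : 𝓢(EuclideanSpace ℝ (Fin 3), EuclideanSpace ℝ (Fin 3)), VectorCalculus.IsDivFree ⇑u₀ →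
        ∃ T : ℝ, 0 < T ∧ ∃ u : ℝ → L2C, 𝒜.IsMildSolution (schwartzL2 u₀) (Ico 0 T) u) :
    ¬ ∀ 𝒜 : AveragingDatum, 𝒜.IsSymmetric → 𝒜.HasCancellation →
        ∀ u₀ : 𝓢(EuclideanSpace ℝ (Fin 3), EuclideanSpace ℝ (Fin 3)), VectorCalculus.IsDivFree ⇑u₀ →
          ∀ T : ℝ, 0 < T → ∀ u : ℝ → L2C, 𝒜.IsMildSolution (schwartzL2 u₀) (Ico 0 T) u →
            ∃ T' : ℝ, T < T' ∧ ∃ v : ℝ → L2C,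
              𝒜.IsMildSolution (schwartzL2 u₀) (Ico 0 T') v ∧ ∀ t ∈ Ico 0 T, v t = u t := by
  intro h
  obtain ⟨𝒜, hs, hc, u₀, hdiv, T, hT, u, hmild, hno⟩ := exists_nonextendable_of_localExistence hloc
  exact hno (h 𝒜 hs hc u₀ hdiv T hT u hmild)

end Summit.NavierStokesRegularity.NavierStokesRegularity.Theorems.Thesis.Negative

end
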